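import Literature.Analysis.FunctionSpaces.HolderManifoldSchauder
import Literature.Analysis.FunctionSpaces.HolderManifoldModelIsomorphism
import Literature.Analysis.FunctionSpaces.HolderManifoldModelEllipticity
import Literature.Analysis.FunctionSpaces.HolderManifoldRegularity
import Literature.Analysis.OperatorTheory.MethodOfContinuity
import Literature.Geometry.Riemannian.GurskyViaclovskyLinearisation
import Summits.SmoothPoincare4.SmoothPoincare4.Theorems.EntropyRungChangGurskyYangStubModelEstimate
import Summits.SmoothPoincare4.SmoothPoincare4.Theorems.EntropyRungChangGurskyYangHelperSegmentSupBound
import HarnessLib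

/-!
# Stub O2b `stub_linearisedInvertible_of_chartRep` (line `margerin-cone-hamilton-rails`,
crux `EntropyRung.ChangGurskyYang`, stmt-SmoothPoincare4-10834)

Gursky–Viaclovsky 2003, Prop. 2: at a smooth admissible solution `w` of the weighted `σ₂` path
equation (`t ≤ 1`, `q > 0`) the linearisation `L = 𝓛_{t,w} + 4 q e^{−4w}` is an invertible
bounded operator `C^{2,α}_𝔄(M) → C^{0,α}_𝔄(M)`. Here this is derived from the
chart-representation package of `−L` (stub O2a, a hypothesis) by the METHOD OF CONTINUITY
(Gilbarg–Trudinger 2001, Thm. 5.2, `bijective_of_surjective_of_forall_norm_le_lineMap`) along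
`L_s = (1 − s)(Δ_g − 1) + s(−L)`: the model operator `Δ_g − 1` has its own package
(`modelOperator_chartRepPackage`, the data of stub O5 `stub_modelEstimate`) and is onto
(`modelOperator_bijective_of_estimate` + `stub_modelEstimate`); the convex-combination
coefficients of `L_s` obey common bounds, so ONE constant of `exists_schauder_global` serves all
`s`, and the `sup |u|` term is removed by `helper_segmentSupBound`, uniformly in `s`; hence `−L`,
so `L`, is bijective, and `ContinuousLinearEquiv.ofBijective` (open mapping) concludes.

## References

* M. J. Gursky, J. A. Viaclovsky, J. Differential Geom. 63 (2003) 131–154, Prop. 2, §5.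
  [GurskyViaclovsky2003]
* D. Gilbarg, N. S. Trudinger, *Elliptic Partial Differential Equations of Second Order* (2001),
  Thm. 5.2, Thm. 6.2, §6.3. [GilbargTrudinger2001]
-/

noncomputable section

set_option linter.dupNamespace false

open Set Function Filter
open scoped Manifold ContDiff Topology NNReal
open Literature.Analysis.FunctionSpaces Literature.Geometry.Riemannian
  Literature.Geometry.Riemannian.GurskyViaclovskyPath
open Literature.Geometry.Lorentzian Literature.Geometry.Lorentzian.PseudoRiemannianMetric

namespace Summit.SmoothPoincare4.SmoothPoincare4.Theorems.MargerinRails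

/-- The chart representation of a convex combination of two represented operators. [folklore] -/
theorem segment_rep_algebra {κ : Type*} [Fintype κ] (s p r c₀ c₁ : ℝ) (G₀ G₁ D2 : κ → κ → ℝ)
    (F₀ F₁ D1 : κ → ℝ) :
    (1 - s) * (p * ((∑ i, ∑ i', G₀ i i' * D2 i i') + (∑ l, F₀ l * D1 l) + c₀ * r)) +
        s * (p * ((∑ i, ∑ i', G₁ i i' * D2 i i') + (∑ l, F₁ l * D1 l) + c₁ * r)) =
      p * ((∑ i, ∑ i', ((1 - s) * G₀ i i' + s * G₁ i i') * D2 i i') +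
        (∑ l, ((1 - s) * F₀ l + s * F₁ l) * D1 l) + ((1 - s) * c₀ + s * c₁) * r) := by
  have h2 : (∑ i, ∑ i', ((1 - s) * G₀ i i' + s * G₁ i i') * D2 i i') =
      (1 - s) * (∑ i, ∑ i', G₀ i i' * D2 i i') + s * ∑ i, ∑ i', G₁ i i' * D2 i i' := by
    simp only [Finset.mul_sum, ← Finset.sum_add_distrib]
    exact Finset.sum_congr rfl fun i _ => Finset.sum_congr rfl fun i' _ => by ring
  have h1 : (∑ l, ((1 - s) * F₀ l + s * F₁ l) * D1 l) =
      (1 - s) * (∑ l, F₀ l * D1 l) + s * ∑ l, F₁ l * D1 l := by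
    simp only [Finset.mul_sum, ← Finset.sum_add_distrib]
    exact Finset.sum_congr rfl fun l _ => by ring
  rw [h2, h1]
  ring

/-- `‖(1−s)x + s y‖ ≤ A + B` for `s ∈ [0,1]`, `‖x‖ ≤ A`, `‖y‖ ≤ B`. [folklore] -/
theorem norm_segment_le {s : ℝ} (hs : s ∈ Icc (0 : ℝ) 1) {x y : ℝ} {A B : ℝ≥0} (hx : ‖x‖ ≤ A)
    (hy : ‖y‖ ≤ B) : ‖(1 - s) * x + s * y‖ ≤ ((A + B : ℝ≥0) : ℝ) := by
  refine (norm_add_le _ _).trans ?_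
  rw [norm_mul, norm_mul, Real.norm_of_nonneg (sub_nonneg.2 hs.2), Real.norm_of_nonneg hs.1,
    NNReal.coe_add]
  nlinarith [hs.1, hs.2, norm_nonneg x, norm_nonneg y, A.coe_nonneg, B.coe_nonneg]

/-- Hölder bound of a convex combination on a set: the constants add (`s ∈ [0,1]`). [folklore] -/
theorem holderOnWith_segment {X : Type*} [PseudoMetricSpace X] {S : Set X} {r : ℝ≥0} {s : ℝ}
    (hs : s ∈ Icc (0 : ℝ) 1) {f f' : X → ℝ} {A B : ℝ≥0} (hf : HolderOnWith A r f S)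
    (hf' : HolderOnWith B r f' S) :
    HolderOnWith (A + B) r (fun x => (1 - s) * f x + s * f' x) S := by
  have key : ∀ c : ℝ, 0 ≤ c → c ≤ 1 → ∀ u v : ℝ, edist (c * u) (c * v) ≤ edist u v := by
    intro c hc0 hc1 u v
    have h := edist_smul₀ c u v
    simp only [smul_eq_mul, ENNReal.smul_def] at h
    rw [h]
    refine mul_le_of_le_one_left zero_le (ENNReal.coe_le_one_iff.2 ?_)
    rw [← NNReal.coe_le_coe, coe_nnnorm, Real.norm_of_nonneg hc0, NNReal.coe_one]
    exact hc1
  intro x hx y hy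
  calc edist ((1 - s) * f x + s * f' x) ((1 - s) * f y + s * f' y)
      ≤ edist ((1 - s) * f x) ((1 - s) * f y) + edist (s * f' x) (s * f' y) :=
        edist_add_add_le _ _ _ _
    _ ≤ edist (f x) (f y) + edist (f' x) (f' y) :=
        add_le_add (key _ (sub_nonneg.2 hs.2) (by linarith [hs.1]) _ _) (key _ hs.1 hs.2 _ _)
    _ ≤ A * edist x y ^ (r : ℝ) + B * edist x y ^ (r : ℝ) :=
        add_le_add (hf x hx y hy) (hf' x hx y hy)
    _ = ((A + B : ℝ≥0) : ENNReal) * edist x y ^ (r : ℝ) := by rw [ENNReal.coe_add, add_mul]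

/-- **The Schauder input package of the model operator `L₀ = Δ_g − 1`** (the data assembled in
stub O5 `stub_modelEstimate`, recorded with its representation): coefficients `η_j Ĝ⁻¹`
(symmetric, uniformly elliptic on the plateau thickenings: `gramInv_symm`, `gramInv_quadratic_pos`,
`exists_ellipticity_const_of_continuousOn`), `η_j b`, `−1`, bounded and Hölder
(`exists_bound_holderWith_of_hasCompactSupport`), and the representation of every operator acting
pointwise as `Δ_g − 1` (`dalembertianPieceCLM_apply_eq`). [cite: GilbargTrudinger2001, §6.1] -/
theorem modelOperator_chartRepPackage
    (M : Type) [TopologicalSpace M] [ChartedSpace (EuclideanSpace ℝ (Fin 4)) M]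
    [IsManifold (𝓡 4) ∞ M] [CompactSpace M] {ι : Type} [Fintype ι]
    (𝔄 : HolderChartData ι (EuclideanSpace ℝ (Fin 4)) M)
    (g : PseudoRiemannianMetric (𝓡 4) ∞ (EuclideanSpace ℝ (Fin 4))
      (TangentSpace (𝓡 4) : M → Type _))
    [g.HasLeviCivita] (hg : g.IsRiemannian) {α : ℝ≥0} (hα1 : α < 1) :
    ∃ (a : ι → Fin 4 → Fin 4 → EuclideanSpace ℝ (Fin 4) → ℝ)
      (b : ι → Fin 4 → EuclideanSpace ℝ (Fin 4) → ℝ) (c : ι → EuclideanSpace ℝ (Fin 4) → ℝ)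
      (ρ₁ l L : ℝ) (Ka Kb Kc : ℝ≥0),
      0 < ρ₁ ∧ 0 < l ∧ (∀ j i i' x, a j i i' x = a j i' i x) ∧
      (∀ j, ∀ x ∈ Metric.thickening ρ₁ (𝔄.chart j '' tsupport (𝔄.ρ j)), ∀ ξ : Fin 4 → ℝ,
        l * ∑ i, ξ i ^ 2 ≤ ∑ i, ∑ i', a j i i' x * ξ i * ξ i') ∧
      (∀ j, ∀ x ∈ Metric.thickening ρ₁ (𝔄.chart j '' tsupport (𝔄.ρ j)), ∀ ξ : Fin 4 → ℝ,
        ∑ i, ∑ i', a j i i' x * ξ i * ξ i' ≤ L * ∑ i, ξ i ^ 2) ∧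
      (∀ j i i', ∀ x ∈ Metric.thickening ρ₁ (𝔄.chart j '' tsupport (𝔄.ρ j)), ‖a j i i' x‖ ≤ Ka) ∧
      (∀ j i i', HolderOnWith Ka α (a j i i')
        (Metric.thickening ρ₁ (𝔄.chart j '' tsupport (𝔄.ρ j)))) ∧
      (∀ j l' x, x ∈ Metric.thickening ρ₁ (𝔄.chart j '' tsupport (𝔄.ρ j)) → ‖b j l' x‖ ≤ Kb) ∧
      (∀ j l', HolderOnWith Kb α (b j l')
        (Metric.thickening ρ₁ (𝔄.chart j '' tsupport (𝔄.ρ j)))) ∧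
      (∀ j, ∀ x ∈ Metric.thickening ρ₁ (𝔄.chart j '' tsupport (𝔄.ρ j)), ‖c j x‖ ≤ Kc) ∧
      (∀ j, HolderOnWith Kc α (c j) (Metric.thickening ρ₁ (𝔄.chart j '' tsupport (𝔄.ρ j)))) ∧
      ∀ (L₀ : HolderManifoldFunction 𝔄 ℝ 2 α →L[ℝ] HolderManifoldFunction 𝔄 ℝ 0 α),
        (∀ (u : HolderManifoldFunction 𝔄 ℝ 2 α) (x : M), L₀ u x = g.dalembertian u x - u x) →
        ∀ (u : HolderManifoldFunction 𝔄 ℝ 2 α) (j : ι) (y : EuclideanSpace ℝ (Fin 4)),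
          𝔄.piece (L₀ u) j y = 𝔄.piece (fun _ : M => (1 : ℝ)) j y *
            ((∑ i, ∑ i', a j i i' y * iteratedFDeriv ℝ 2
                (chartRestrictCLM 𝔄 hα1.le j (𝔄.cutoff j) (𝔄.contDiff_cutoff j)
                  (𝔄.hasCompactSupport_cutoff j) (𝔄.tsupport_cutoff_subset j) u :
                    EuclideanSpace ℝ (Fin 4) → ℝ) y
                ![(EuclideanSpace.basisFun (Fin 4) ℝ) i, (EuclideanSpace.basisFun (Fin 4) ℝ) i']) +
              (∑ l', b j l' y * fderiv ℝ
                (chartRestrictCLM 𝔄 hα1.le j (𝔄.cutoff j) (𝔄.contDiff_cutoff j)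
                  (𝔄.hasCompactSupport_cutoff j) (𝔄.tsupport_cutoff_subset j) u :
                    EuclideanSpace ℝ (Fin 4) → ℝ) y ((EuclideanSpace.basisFun (Fin 4) ℝ) l')) +
              c j y * (chartRestrictCLM 𝔄 hα1.le j (𝔄.cutoff j) (𝔄.contDiff_cutoff j)
                  (𝔄.hasCompactSupport_cutoff j) (𝔄.tsupport_cutoff_subset j) u) y) := by
  -- adapted from the proof of `stub_modelEstimate`
  set bE : OrthonormalBasis (Fin 4) ℝ (EuclideanSpace ℝ (Fin 4)) :=
    EuclideanSpace.basisFun (Fin 4) ℝ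
  have h1top : ((1 : ℕ) : WithTop ℕ∞) ≤ ((⊤ : ℕ∞) : WithTop ℕ∞) := WithTop.coe_le_coe.mpr le_top
  obtain ⟨ρ₁, hρ₁, hη1⟩ := 𝔄.exists_cthickening_cutoff_eq_one
  set K' : ι → Set (EuclideanSpace ℝ (Fin 4)) := fun j =>
    Metric.cthickening ρ₁ (𝔄.chart j '' tsupport (𝔄.ρ j))
  have hK'c : ∀ j, IsCompact (K' j) := fun j => (𝔄.isCompact_image_tsupport j).1.cthickening
  have hK't : ∀ j, K' j ⊆ (𝔄.chart j).target := fun j y hy =>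
    𝔄.mem_target_of_cutoff_ne_zero (by rw [hη1 j y hy]; exact one_ne_zero)
  have hthick : ∀ j, Metric.thickening ρ₁ (𝔄.chart j '' tsupport (𝔄.ρ j)) ⊆ K' j := fun j =>
    Metric.thickening_subset_cthickening _ _
  have hl' : ∀ j, ∃ lam : ℝ, 0 < lam ∧ ∀ y ∈ K' j, ∀ ξ : Fin 4 → ℝ, lam * ∑ i, ξ i ^ 2 ≤
      ∑ i, ∑ i', gramInv bE.toBasis g (𝔄.center j) y i i' * ξ i * ξ i' := fun j =>
    exists_ellipticity_const_of_continuousOn (hK'c j)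
      (fun i i' => (contDiffOn_gramInv bE.toBasis g (𝔄.center j) i i').continuousOn.mono (hK't j))
      (fun y hy ξ hξ => gramInv_quadratic_pos bE.toBasis g (𝔄.center j) hg (hK't j hy) hξ)
  choose lam hlam0 hlam using hl'
  obtain ⟨l, hl, hlle⟩ := exists_pos_forall_le_of_finite hlam0
  set acoef : ι → Fin 4 → Fin 4 → EuclideanSpace ℝ (Fin 4) → ℝ := fun j i i' y =>
    𝔄.cutoff j y * gramInv bE.toBasis g (𝔄.center j) y i i' with hacoef
  set bcoef : ι → Fin 4 → EuclideanSpace ℝ (Fin 4) → ℝ := fun j l' y =>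
    𝔄.cutoff j y * firstOrderCoeff bE.toBasis g (𝔄.center j) l' y with hbcoef
  set ccoef : ι → EuclideanSpace ℝ (Fin 4) → ℝ := fun _ _ => -1 with hccoef
  have haS : ∀ j i i', ContDiff ℝ ∞ (acoef j i i') := fun j i i' =>
    ContDiffHolderFunction.contDiff_cutoff_mul (𝔄.contDiff_cutoff j) (𝔄.chart j).open_target
      (contDiffOn_gramInv bE.toBasis g (𝔄.center j) i i') (𝔄.tsupport_cutoff_subset j)
  have hbS : ∀ j l', ContDiff ℝ ∞ (bcoef j l') := fun j l' =>
    ContDiffHolderFunction.contDiff_cutoff_mul (𝔄.contDiff_cutoff j) (𝔄.chart j).open_target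
      (contDiffOn_firstOrderCoeff bE.toBasis g (𝔄.center j) l') (𝔄.tsupport_cutoff_subset j)
  choose Zs Zh hZ using fun j i i' => exists_bound_holderWith_of_hasCompactSupport
    ((haS j i i').of_le (by exact_mod_cast h1top))
    (ContDiffHolderFunction.hasCompactSupport_cutoff_mul (𝔄.hasCompactSupport_cutoff j) _) hα1.le
  choose Ws Wh hW using fun j l' => exists_bound_holderWith_of_hasCompactSupport
    ((hbS j l').of_le (by exact_mod_cast h1top))
    (ContDiffHolderFunction.hasCompactSupport_cutoff_mul (𝔄.hasCompactSupport_cutoff j) _) hα1.le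
  set Ka : ℝ≥0 := Finset.univ.sup (fun q : ι × Fin 4 × Fin 4 =>
    Zs q.1 q.2.1 q.2.2 + Zh q.1 q.2.1 q.2.2)
  set Kb : ℝ≥0 := Finset.univ.sup (fun q : ι × Fin 4 => Ws q.1 q.2 + Wh q.1 q.2)
  have hKa' : ∀ j i i', Zs j i i' ≤ Ka ∧ Zh j i i' ≤ Ka := fun j i i' => by
    have h := Finset.le_sup
      (f := fun q : ι × Fin 4 × Fin 4 => Zs q.1 q.2.1 q.2.2 + Zh q.1 q.2.1 q.2.2)
      (Finset.mem_univ (j, i, i'))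
    exact ⟨le_self_add.trans h, le_add_self.trans h⟩
  have hKb' : ∀ j l', Ws j l' ≤ Kb ∧ Wh j l' ≤ Kb := fun j l' => by
    have h := Finset.le_sup (f := fun q : ι × Fin 4 => Ws q.1 q.2 + Wh q.1 q.2)
      (Finset.mem_univ (j, l'))
    exact ⟨le_self_add.trans h, le_add_self.trans h⟩
  have ha0 : ∀ j i i' y, ‖acoef j i i' y‖ ≤ Ka := fun j i i' y =>
    ((hZ j i i').1 y).trans (NNReal.coe_le_coe.2 (hKa' j i i').1)
  refine ⟨acoef, bcoef, ccoef, ρ₁, l, Fintype.card (Fin 4) * Ka, Ka, Kb, 1, hρ₁, hl,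
    fun j i i' y => ?_, fun j y hy ξ => ?_, fun j y _ ξ => ?_, fun j i i' y _ => ha0 j i i' y,
    fun j i i' => ((hZ j i i').2.mono (hKa' j i i').2).holderOnWith _,
    fun j l' y _ => ((hW j l').1 y).trans (NNReal.coe_le_coe.2 (hKb' j l').1),
    fun j l' => ((hW j l').2.mono (hKb' j l').2).holderOnWith _,
    fun j y _ => by simp [hccoef],
    fun j y _ y' _ => by simp only [hccoef, PseudoEMetricSpace.edist_self, zero_le],
    fun L₀ hL₀ v j y => ?_⟩
  · exact congrArg (fun t : ℝ => 𝔄.cutoff j y * t) (gramInv_symm bE.toBasis g (𝔄.center j) y i i')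
  · have hyK : y ∈ K' j := hthick j hy
    calc l * ∑ i, ξ i ^ 2 ≤ lam j * ∑ i, ξ i ^ 2 :=
          mul_le_mul_of_nonneg_right (hlle j) (Finset.sum_nonneg fun i _ => sq_nonneg _)
      _ ≤ ∑ i, ∑ i', gramInv bE.toBasis g (𝔄.center j) y i i' * ξ i * ξ i' := hlam j y hyK ξ
      _ = ∑ i, ∑ i', acoef j i i' y * ξ i * ξ i' := by simp only [hacoef, hη1 j y hyK, one_mul]
  · exact quadratic_le_card_mul_of_abs_le
      (fun i i' => by rw [← Real.norm_eq_abs]; exact ha0 j i i' y) ξ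
  · have hv : (⇑(L₀ v) : M → ℝ) = g.dalembertian ⇑v - ⇑v := funext fun x => hL₀ v x
    have hL : dalembertianPieceCLM 𝔄 bE.toBasis g hα1.le j v y =
        𝔄.piece (fun _ : M => (1 : ℝ)) j y * (𝔄.cutoff j y *
          ((∑ a, ∑ b, gramInv bE.toBasis g (𝔄.center j) y a b *
              fderiv ℝ (fderiv ℝ (chartRestrictCLM 𝔄 hα1.le j (𝔄.cutoff j) (𝔄.contDiff_cutoff j)
                (𝔄.hasCompactSupport_cutoff j) (𝔄.tsupport_cutoff_subset j) v :
                  EuclideanSpace ℝ (Fin 4) → ℝ)) y (bE.toBasis a) (bE.toBasis b)) +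
            (∑ l', firstOrderCoeff bE.toBasis g (𝔄.center j) l' y *
              fderiv ℝ (chartRestrictCLM 𝔄 hα1.le j (𝔄.cutoff j) (𝔄.contDiff_cutoff j)
                (𝔄.hasCompactSupport_cutoff j) (𝔄.tsupport_cutoff_subset j) v :
                  EuclideanSpace ℝ (Fin 4) → ℝ) y (bE.toBasis l')) +
            0 * (chartRestrictCLM 𝔄 hα1.le j (𝔄.cutoff j) (𝔄.contDiff_cutoff j)
                (𝔄.hasCompactSupport_cutoff j) (𝔄.tsupport_cutoff_subset j) v) y)) := by
      simp only [dalembertianPieceCLM, ContinuousLinearMap.coe_comp, Function.comp_apply,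
        ContDiffHolderFunction.coeffCLM_apply, smul_eq_mul,
        ContDiffHolderFunction.localizedOperatorCLM_apply]
    rw [hv, 𝔄.piece_sub, Pi.sub_apply, ← dalembertianPieceCLM_apply_eq 𝔄 bE.toBasis g hα1.le j v y,
      hL, HolderChartData.piece_eq_piece_one_mul 𝔄 hα1.le v j y]
    simp only [OrthonormalBasis.coe_toBasis, iteratedFDeriv_two_apply, Matrix.cons_val_zero,
      Matrix.cons_val_one, hacoef, hbcoef, hccoef]
    exact modelEstimate_rep_algebra _ _ _ _ _ _ _

/-- **STUB O2b — INVERTIBILITY OF THE LINEARISED PATH OPERATOR FROM ITS CHART REPRESENTATION**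
(Gursky–Viaclovsky 2003, Prop. 2, by the method of continuity, Gilbarg–Trudinger 2001, Thm. 5.2):
GIVEN the chart-representation package of `−(𝓛_{t,w} + 4 q e^{−4w})` (stub O2a), every bounded
`L : C^{2,α}_𝔄 → C^{0,α}_𝔄` acting pointwise as `𝓛_{t,w} + 4 q e^{−4w}` is invertible: along
`L_s = (1 − s)(Δ_g − 1) + s(−L)` one Schauder constant (`exists_schauder_global`) and one
maximum-principle constant (`helper_segmentSupBound`) give `‖u‖ ≤ C‖L_s u‖` uniformly in
`s ∈ [0,1]`; `Δ_g − 1` is onto (`stub_modelEstimate`, `modelOperator_bijective_of_estimate`), so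
`−L`, hence `L`, is bijective.
[cite: GurskyViaclovsky2003, Prop. 2; GilbargTrudinger2001, Thm. 5.2] -/
theorem stub_linearisedInvertible_of_chartRep :
    ∀ (M : Type) [TopologicalSpace M] [T2Space M] [ChartedSpace (EuclideanSpace ℝ (Fin 4)) M]
      [IsManifold (modelWithCornersSelf ℝ (EuclideanSpace ℝ (Fin 4))) ((⊤ : ℕ∞) : WithTop ℕ∞) M]
      [CompactSpace M] {ι : Type} [Fintype ι]
      (𝔄 : Literature.Analysis.FunctionSpaces.HolderChartData ι (EuclideanSpace ℝ (Fin 4)) M)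
      (g : Literature.Geometry.Lorentzian.PseudoRiemannianMetric
        (modelWithCornersSelf ℝ (EuclideanSpace ℝ (Fin 4))) ((⊤ : ℕ∞) : WithTop ℕ∞)
        (EuclideanSpace ℝ (Fin 4))
        (TangentSpace (modelWithCornersSelf ℝ (EuclideanSpace ℝ (Fin 4))) : M → Type _))
      [g.HasLeviCivita], g.IsRiemannian →
      ∀ (q : M → ℝ), ContMDiff (modelWithCornersSelf ℝ (EuclideanSpace ℝ (Fin 4)))
        (modelWithCornersSelf ℝ ℝ) ((⊤ : ℕ∞) : WithTop ℕ∞) q → (∀ x, 0 < q x) →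
      ∀ {α : NNReal}, 0 < α → ∀ (hα1 : α < 1) (t : ℝ), t ≤ 1 →
      ∀ (w : M → ℝ), ContMDiff (modelWithCornersSelf ℝ (EuclideanSpace ℝ (Fin 4)))
        (modelWithCornersSelf ℝ ℝ) ((⊤ : ℕ∞) : WithTop ℕ∞) w →
      (∀ x, 0 < Literature.Geometry.Riemannian.GurskyViaclovskyPath.backgroundScalar g w x) →
      (∀ x, Literature.Geometry.Riemannian.GurskyViaclovskyPath.backgroundPathOperator g t w x =
        q x * Real.exp (-4 * w x)) →
      (∃ (a : ι → Fin 4 → Fin 4 → EuclideanSpace ℝ (Fin 4) → ℝ)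
        (b : ι → Fin 4 → EuclideanSpace ℝ (Fin 4) → ℝ) (c : ι → EuclideanSpace ℝ (Fin 4) → ℝ)
        (ρ₁ l L : ℝ) (Ka Kb Kc : NNReal),
        0 < ρ₁ ∧ 0 < l ∧ (∀ j i i' x, a j i i' x = a j i' i x) ∧
        (∀ j, ∀ x ∈ Metric.thickening ρ₁ (𝔄.chart j '' tsupport (𝔄.ρ j)), ∀ ξ : Fin 4 → ℝ,
          l * ∑ i, ξ i ^ 2 ≤ ∑ i, ∑ i', a j i i' x * ξ i * ξ i') ∧
        (∀ j, ∀ x ∈ Metric.thickening ρ₁ (𝔄.chart j '' tsupport (𝔄.ρ j)), ∀ ξ : Fin 4 → ℝ,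
          ∑ i, ∑ i', a j i i' x * ξ i * ξ i' ≤ L * ∑ i, ξ i ^ 2) ∧
        (∀ j i i', ∀ x ∈ Metric.thickening ρ₁ (𝔄.chart j '' tsupport (𝔄.ρ j)), ‖a j i i' x‖ ≤ Ka) ∧
        (∀ j i i', HolderOnWith Ka α (a j i i')
          (Metric.thickening ρ₁ (𝔄.chart j '' tsupport (𝔄.ρ j)))) ∧
        (∀ j l' x, x ∈ Metric.thickening ρ₁ (𝔄.chart j '' tsupport (𝔄.ρ j)) → ‖b j l' x‖ ≤ Kb) ∧
        (∀ j l', HolderOnWith Kb α (b j l')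
          (Metric.thickening ρ₁ (𝔄.chart j '' tsupport (𝔄.ρ j)))) ∧
        (∀ j, ∀ x ∈ Metric.thickening ρ₁ (𝔄.chart j '' tsupport (𝔄.ρ j)), ‖c j x‖ ≤ Kc) ∧
        (∀ j, HolderOnWith Kc α (c j) (Metric.thickening ρ₁ (𝔄.chart j '' tsupport (𝔄.ρ j)))) ∧
        ∀ (L' : Literature.Analysis.FunctionSpaces.HolderManifoldFunction 𝔄 ℝ 2 α →L[ℝ]
            Literature.Analysis.FunctionSpaces.HolderManifoldFunction 𝔄 ℝ 0 α),
          (∀ (φ : Literature.Analysis.FunctionSpaces.HolderManifoldFunction 𝔄 ℝ 2 α) (x : M),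
            L' φ x = Literature.Geometry.Riemannian.GurskyViaclovskyPath.linearisedBackgroundOperator
              g t w φ x + 4 * q x * Real.exp (-4 * w x) * φ x) →
          ∀ (u : Literature.Analysis.FunctionSpaces.HolderManifoldFunction 𝔄 ℝ 2 α) (j : ι)
            (y : EuclideanSpace ℝ (Fin 4)) (v : EuclideanSpace ℝ (Fin 4) → ℝ),
            v = Literature.Analysis.FunctionSpaces.chartRestrictCLM 𝔄 hα1.le j (𝔄.cutoff j)
                    (𝔄.contDiff_cutoff j) (𝔄.hasCompactSupport_cutoff j)
                    (𝔄.tsupport_cutoff_subset j) u →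
            𝔄.piece ((-L') u) j y = 𝔄.piece (fun _ : M => (1 : ℝ)) j y *
              ((∑ i, ∑ i', a j i i' y * iteratedFDeriv ℝ 2 v y
                  ![(EuclideanSpace.basisFun (Fin 4) ℝ) i, (EuclideanSpace.basisFun (Fin 4) ℝ) i']) +
                (∑ l', b j l' y * fderiv ℝ v y ((EuclideanSpace.basisFun (Fin 4) ℝ) l')) +
                c j y * v y)) →
      ∀ L : Literature.Analysis.FunctionSpaces.HolderManifoldFunction 𝔄 ℝ 2 α →L[ℝ]
          Literature.Analysis.FunctionSpaces.HolderManifoldFunction 𝔄 ℝ 0 α,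
        (∀ (φ : Literature.Analysis.FunctionSpaces.HolderManifoldFunction 𝔄 ℝ 2 α) (x : M),
          L φ x = Literature.Geometry.Riemannian.GurskyViaclovskyPath.linearisedBackgroundOperator
            g t w φ x + 4 * q x * Real.exp (-4 * w x) * φ x) →
        L.IsInvertible := by
  intro M _ _ _ _ _ ι _ 𝔄 g _ hg q hq hq0 α hα0 hα1 t ht w hw hpos heq hpkg L hL
  set bE : OrthonormalBasis (Fin 4) ℝ (EuclideanSpace ℝ (Fin 4)) :=
    EuclideanSpace.basisFun (Fin 4) ℝ
  -- Step 0: the two coefficient packages (model operator; `−L`, the hypothesis)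
  obtain ⟨a₀, b₀, c₀, ρ₀, l₀, U₀, Ka₀, Kb₀, Kc₀, hρ₀, hl₀, hsy₀, hlo₀, hup₀, ha₀, haH₀, hb₀, hbH₀,
    hc₀, hcH₀, hrep₀⟩ := modelOperator_chartRepPackage M 𝔄 g hg hα1
  obtain ⟨a₁, b₁, c₁, ρ₁, l₁, U₁, Ka₁, Kb₁, Kc₁, hρ₁, hl₁, hsy₁, hlo₁, hup₁, ha₁, haH₁, hb₁, hbH₁,
    hc₁, hcH₁, hrep₁⟩ := hpkg
  -- Step 1: the model operator `L₀ = Δ_g − 1` on `C^{2,α}_𝔄`, onto by stub O5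
  obtain ⟨C₅, hC₅⟩ := stub_modelEstimate M 𝔄 g hg hα0 hα1
  obtain ⟨L₀, hL₀, h₀⟩ : ∃ L₀ : HolderManifoldFunction 𝔄 ℝ 2 α →L[ℝ] HolderManifoldFunction 𝔄 ℝ 0 α,
      (∀ (u : HolderManifoldFunction 𝔄 ℝ 2 α) (x : M), L₀ u x = g.dalembertian u x - u x) ∧
        Surjective L₀ :=
    ⟨modelOperatorCLM (k := 0) 𝔄 g hα1.le, fun u x => rfl,
      (modelOperator_bijective_of_estimate 𝔄 g (by norm_num) hg hα0 hα1.le hC₅).2⟩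
  -- Step 2: one Schauder constant for the whole segment (common coefficient bounds)
  set K : ι → Set (EuclideanSpace ℝ (Fin 4)) := fun j => 𝔄.chart j '' tsupport (𝔄.ρ j)
  have hT₀ : ∀ j, Metric.thickening (min ρ₀ ρ₁) (K j) ⊆ Metric.thickening ρ₀ (K j) := fun j =>
    Metric.thickening_mono (min_le_left _ _) _
  have hT₁ : ∀ j, Metric.thickening (min ρ₀ ρ₁) (K j) ⊆ Metric.thickening ρ₁ (K j) := fun j =>
    Metric.thickening_mono (min_le_right _ _) _
  obtain ⟨C, -, hC⟩ := exists_schauder_global 𝔄 bE hα0 hα1 (lt_min hl₀ hl₁) (max U₀ U₁)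
    (Ka₀ + Ka₁) (Kb₀ + Kb₁) (Kc₀ + Kc₁) (lt_min hρ₀ hρ₁)
  -- Step 3: the maximum-principle constant, uniform along the segment
  have h2top : ((2 : ℕ) : WithTop ℕ∞) ≤ ((⊤ : ℕ∞) : WithTop ℕ∞) := WithTop.coe_le_coe.mpr le_top
  obtain ⟨C₀, hC₀⟩ := helper_segmentSupBound M g hg q hq.continuous hq0 t ht w
    (hw.of_le (by exact_mod_cast h2top)) hpos heq
  -- Step 4: the uniform estimate `‖u‖ ≤ C' ‖L_s u‖` along `L_s = (1 − s) L₀ + s (−L)`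
  have key : ∀ s ∈ Icc (0 : ℝ) 1, ∀ u : HolderManifoldFunction 𝔄 ℝ 2 α,
      ‖u‖ ≤ C * (1 + C₀ * Fintype.card ι) * ‖((1 - s) • L₀ + s • (-L)) u‖ := by
    intro s hs u
    -- the coefficients of `L_s`
    set aS : ι → Fin 4 → Fin 4 → EuclideanSpace ℝ (Fin 4) → ℝ := fun j i i' y =>
      (1 - s) * a₀ j i i' y + s * a₁ j i i' y with haS
    set bS : ι → Fin 4 → EuclideanSpace ℝ (Fin 4) → ℝ := fun j l' y =>
      (1 - s) * b₀ j l' y + s * b₁ j l' y with hbS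
    set cS : ι → EuclideanSpace ℝ (Fin 4) → ℝ := fun j y => (1 - s) * c₀ j y + s * c₁ j y with hcS
    have hquad : ∀ j y (ξ : Fin 4 → ℝ), (∑ i, ∑ i', aS j i i' y * ξ i * ξ i') =
        (1 - s) * (∑ i, ∑ i', a₀ j i i' y * ξ i * ξ i') + s * ∑ i, ∑ i', a₁ j i i' y * ξ i * ξ i' :=
      fun j y ξ => by
        simp only [haS, Finset.mul_sum, ← Finset.sum_add_distrib]
        exact Finset.sum_congr rfl fun i _ => Finset.sum_congr rfl fun i' _ => by ring
    set f : HolderManifoldFunction 𝔄 ℝ 0 α := ((1 - s) • L₀ + s • (-L)) u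
    -- the `sup |u|` bound by the maximum principle
    have hfy : ∀ y, f y = (1 - s) * (g.dalembertian u y - u y) -
        s * (linearisedBackgroundOperator g t w u y + 4 * q y * Real.exp (-4 * w y) * u y) := by
      intro y
      show (1 - s) * L₀ u y + s * (-(L u y)) = _
      rw [hL₀, hL]
      ring
    have hA : ∀ x, ‖u x‖ ≤ C₀ * (Fintype.card ι * ‖f‖) := fun x => by
      rw [Real.norm_eq_abs]
      refine hC₀ s hs u u.contMDiff _ (fun y => ?_) x
      rw [← hfy y, ← Real.norm_eq_abs]
      exact f.norm_apply_le y
    -- the Schauder estimate for `L_s`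
    have hS : ‖u‖ ≤ C * (‖f‖ + C₀ * (Fintype.card ι * ‖f‖)) := by
      refine hC aS bS cS (fun j i i' y => by
          show (1 - s) * a₀ j i i' y + s * a₁ j i i' y = (1 - s) * a₀ j i' i y + s * a₁ j i' i y
          rw [hsy₀ j i i' y, hsy₁ j i i' y])
        (fun j y hy ξ => ?_) (fun j y hy ξ => ?_)
        (fun j i i' y hy => norm_segment_le hs (ha₀ j i i' y (hT₀ j hy)) (ha₁ j i i' y (hT₁ j hy)))
        (fun j i i' =>
          holderOnWith_segment hs ((haH₀ j i i').mono (hT₀ j)) ((haH₁ j i i').mono (hT₁ j)))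
        (fun j l' y hy => norm_segment_le hs (hb₀ j l' y (hT₀ j hy)) (hb₁ j l' y (hT₁ j hy)))
        (fun j l' => holderOnWith_segment hs ((hbH₀ j l').mono (hT₀ j)) ((hbH₁ j l').mono (hT₁ j)))
        (fun j y hy => norm_segment_le hs (hc₀ j y (hT₀ j hy)) (hc₁ j y (hT₁ j hy)))
        (fun j => holderOnWith_segment hs ((hcH₀ j).mono (hT₀ j)) ((hcH₁ j).mono (hT₁ j)))
        ((1 - s) • L₀ + s • (-L)) (fun v j y => ?_) u _ hA
      · -- uniform ellipticity with `min l₀ l₁`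
        have hξ : 0 ≤ ∑ i, ξ i ^ 2 := Finset.sum_nonneg fun i _ => sq_nonneg _
        rw [hquad]
        nlinarith [mul_le_mul_of_nonneg_left ((mul_le_mul_of_nonneg_right (min_le_left l₀ l₁)
          hξ).trans (hlo₀ j y (hT₀ j hy) ξ)) (sub_nonneg.2 hs.2), mul_le_mul_of_nonneg_left
          ((mul_le_mul_of_nonneg_right (min_le_right l₀ l₁) hξ).trans (hlo₁ j y (hT₁ j hy) ξ)) hs.1]
      · -- upper bound with `max U₀ U₁`
        have hξ : 0 ≤ ∑ i, ξ i ^ 2 := Finset.sum_nonneg fun i _ => sq_nonneg _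
        rw [hquad]
        nlinarith [mul_le_mul_of_nonneg_left ((hup₀ j y (hT₀ j hy) ξ).trans
          (mul_le_mul_of_nonneg_right (le_max_left U₀ U₁) hξ)) (sub_nonneg.2 hs.2),
          mul_le_mul_of_nonneg_left ((hup₁ j y (hT₁ j hy) ξ).trans
          (mul_le_mul_of_nonneg_right (le_max_right U₀ U₁) hξ)) hs.1]
      · -- the chart representation of `L_s`
        have e : (⇑(((1 - s) • L₀ + s • (-L)) v) : M → ℝ) = (1 - s) • ⇑(L₀ v) + s • ⇑((-L) v) :=
          rfl
        rw [e, 𝔄.piece_add, 𝔄.piece_smul, 𝔄.piece_smul, Pi.add_apply, Pi.smul_apply,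
          Pi.smul_apply, smul_eq_mul, smul_eq_mul, hrep₀ L₀ hL₀ v j y, hrep₁ L hL v j y _ rfl]
        exact segment_rep_algebra _ _ _ _ _ _ _ _ _ _ _
    calc ‖u‖ ≤ C * (‖f‖ + C₀ * (Fintype.card ι * ‖f‖)) := hS
      _ = C * (1 + C₀ * Fintype.card ι) * ‖f‖ := by ring
  -- Step 5: the method of continuity: `−L` is bijective, hence so is `L`
  have hbij : Bijective (-L) :=
    Literature.Analysis.OperatorTheory.bijective_of_surjective_of_forall_norm_le_lineMap L₀ (-L)
      key h₀
  have hinj : Injective L := fun x y hxy =>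
    hbij.1 (by rw [neg_apply, neg_apply, hxy])
  have hsurj : Surjective L := fun y => by
    obtain ⟨x, hx⟩ := hbij.2 (-y)
    refine ⟨x, neg_inj.1 ?_⟩
    rwa [neg_apply] at hx
  -- Step 6: the open mapping theorem
  exact ⟨ContinuousLinearEquiv.ofBijective L (LinearMap.ker_eq_bot.2 hinj)
    (LinearMap.range_eq_top.2 hsurj), ContinuousLinearEquiv.coe_ofBijective _ _ _⟩

end Summit.SmoothPoincare4.SmoothPoincare4.Theorems.MargerinRails

end
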